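import Summits.CriticalPhenomena.Ising3DConformalLimit.Theorems.HyperoctahedralRPExistsScaleCovariantLimitIntMeshOfBlockLimitsAux
import Summits.CriticalPhenomena.Ising3DConformalLimit.Theorems.HyperoctahedralRPExistsScaleCovariantLimitRegularityGivesPrecompact
import Literature.Probability.LatticeModels.CriticalUrsellFourSign
import HarnessLib

/-!
# De-smearing: block limits + two-point scaling + equicontinuity ⟹ integer-mesh convergence of the pinned
zoom (line `monotone-blocking-port` of crux `ExistsScaleCovariantLimit`, stmt-CriticalPhenomena-1981; stub
`stub_intMesh_of_blockLimits`, S5)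

`Sig.stub_intMesh_of_blockLimits : BlockLimits → TwoPointScaling → MonotoneRG.UniformRegularity →
IntMeshConvergence`. At an integer configuration `y = z ∈ (ℤ³)ⁿ` (injective) the pinned zoom at mesh `1/m`
is `F(m) = ρ_pin(1/m)ⁿ ⟨∏ᵢ σ_{m zᵢ}⟩_{β_c}`; we show `F` is Cauchy.

* Odd `n`: `F ≡ 0` (`criticalCorr_eq_zero_of_odd`); `n = 0`: `F` is constant. Let `n = 2p ≥ 2`.
* COMPACT BALL: `NonCoincident` is open, so a closed ball `K` of radius `r₀` around `y` lies inside it; `K` is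
  compact, and clause (b) of `UniformRegularity` (`ρ★ = ρ_pin`, `rhoStar_eq_rhoPin`) gives for `ε > 0` radii
  `r, δ₀` with `|F★_δ(x) − F★_δ(x')| < ε` for `δ < δ₀`, `x, x' ∈ K`, `dist x x' < r`.
* BLOCK CONFIGURATIONS: pick `j > 4/min(r,r₀)`; for `m` large and `L = ⌊m/j⌋` every block configuration
  `((xᵢ + L j zᵢ)/m)ᵢ`, `xᵢ ∈ cube L`, is within `min(r,r₀)` of `y` (`dist_blockConfig_lt`), so `F(m)` is
  within `ε` of the AVERAGE `A(m)` of the pinned zoom over the `(L³)^{2p}` block configurations.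
* DE-SMEARING IDENTITY (`sum_rescaledCorrelator_blockConfig`):
  `A(m) = R_{2p}(L; j z⃗) · (V(L)/(L⁶ g(m)))^p`, and both factors converge: `R_{2p}(L; jz⃗) → M`
  (`BlockLimits`, `j z⃗` injective) and `V(L)/(L⁶g(m)) → Φ⁻¹ r_j⁻¹` (`TwoPointScaling` with
  `g(jL)/g(m) → 1`, `tendsto_blockCov_div_of_twoPointScaling`).
* CAUCHY: for every `ε` there is a convergent `A` with `|F − A| ≤ ε` eventually, so `F` is Cauchy and
  converges (`ℝ` complete).

References: folklore (de-smearing/averaging argument); the lattice lemmas are in the Aux module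
`…IntMeshOfBlockLimitsAux` (registered sub-goal `intMesh_desmear_aux`). No definitions are introduced.
-/

noncomputable section

namespace Summit.CriticalPhenomena.Ising3DConformalLimit.Cruxes.ExistsScaleCovariantLimit.MonotoneBlockingPort

open Literature.Probability.LatticeModels Filter Set Finset
open scoped Topology BigOperators
open Summit.CriticalPhenomena.Ising3DConformalLimit.MoebiusLimitExistsOnlyInteraction (rhoPin)
open Summit.CriticalPhenomena.Ising3DConformalLimit.Theses
open Summit.CriticalPhenomena.Ising3DConformalLimit.Cruxes.ExistsScaleCovariantLimit.TwoHierarchies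
  (rhoStar_eq_rhoPin)

/-! ### A Cauchy criterion -/

/-- A real sequence which, for every `ε > 0`, is eventually `ε`-close to SOME convergent sequence is Cauchy,
hence convergent. [folklore] -/
private theorem exists_tendsto_of_forall_close {F : ℕ → ℝ}
    (h : ∀ ε > 0, ∃ (A : ℕ → ℝ) (a : ℝ), Tendsto A atTop (𝓝 a) ∧ ∀ᶠ m in atTop, |F m - A m| ≤ ε) :
    ∃ l : ℝ, Tendsto F atTop (𝓝 l) := by
  refine cauchySeq_tendsto_of_complete (Metric.cauchySeq_iff.2 fun ε hε => ?_)
  obtain ⟨A, a, hA, hclose⟩ := h (ε / 4) (by positivity)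
  have hA' : ∀ᶠ m in atTop, |A m - a| < ε / 4 := by
    have h1 := (Metric.tendsto_nhds.1 hA) (ε / 4) (by positivity)
    exact h1.mono fun m hm => by rwa [← Real.dist_eq]
  obtain ⟨N, hN⟩ := eventually_atTop.1 (hclose.and hA')
  refine ⟨N, fun m hm m' hm' => ?_⟩
  obtain ⟨hm1, hm2⟩ := hN m hm
  obtain ⟨hn1, hn2⟩ := hN m' hm'
  rw [Real.dist_eq, abs_sub_lt_iff]
  obtain ⟨h1, h1'⟩ := abs_le.1 hm1
  obtain ⟨h2, h2'⟩ := abs_lt.1 hm2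
  obtain ⟨h3, h3'⟩ := abs_le.1 hn1
  obtain ⟨h4, h4'⟩ := abs_lt.1 hn2
  constructor <;> linarith

/-! ### The stub -/

/-- **S5 — de-smearing: `BlockLimits → TwoPointScaling → UniformRegularity → IntMeshConvergence`.**
At an injective integer configuration `z` and along the meshes `1/m`, the pinned zoom
`F(m) = ρ_pin(1/m)^{2p}⟨∏σ_{m zᵢ}⟩_{β_c}` is, by asymptotic equicontinuity on a compact ball inside
`NonCoincident` (clause (b) of `UniformRegularity`, `ρ★ = ρ_pin`), eventually within `ε` of its average over
the block configurations `((xᵢ + ⌊m/j⌋ j zᵢ)/m)ᵢ`, `xᵢ ∈ cube ⌊m/j⌋` (each within `2(1/j + jZ/m) < r` of `z`),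
and that average equals `R_{2p}(⌊m/j⌋; j z⃗) · (V(L)/(L⁶ g(m)))^p` (de-smearing identity), which converges by
`BlockLimits` (`j z⃗` injective) and `TwoPointScaling` (`g(j⌊m/j⌋)/g(m) → 1`). Hence `F` is Cauchy. Odd
orders vanish (`criticalCorr_eq_zero_of_odd`), order `0` is constant. [folklore] -/
theorem stub_intMesh_of_blockLimits : Sig.stub_intMesh_of_blockLimits := by
  unfold Sig.stub_intMesh_of_blockLimits MonotoneRG.UniformRegularity IntMeshConvergence
  intro hBL hTS hUR n y hy hint
  rw [rhoStar_eq_rhoPin] at hUR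
  choose z hz using hint
  rcases Nat.even_or_odd n with hn | hn
  swap
  · -- odd orders vanish identically
    refine ⟨0, tendsto_const_nhds.congr fun m => ?_⟩
    rw [rescaledCorrelator_apply, criticalCorr_eq_zero_of_odd (d := 3) le_rfl hn, mul_zero]
  obtain ⟨p, hp⟩ := hn
  rcases Nat.eq_zero_or_pos p with hp0 | hp0
  · -- order `0`: a constant sequence
    have hn0 : n = 0 := by omega
    subst hn0
    refine ⟨rescaledCorrelator (criticalCorr 3) rhoPin 0 (1 / ((0 : ℕ) : ℝ)) y,
      tendsto_const_nhds.congr fun m => ?_⟩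
    simp only [rescaledCorrelator_apply, pow_zero, one_mul]
    exact congrArg _ (Subsingleton.elim _ _)
  have hn2 : n = 2 * p := by omega
  subst hn2
  -- `z` is injective since `y` is
  have hz_inj : Function.Injective z := by
    intro i i' h
    refine (mem_nonCoincident y).1 hy (PiLp.ext fun k => ?_)
    rw [hz i k, hz i' k, h]
  -- (1) a compact ball around `y` inside `NonCoincident`, and clause (b) on it
  obtain ⟨r₀, hr₀, hball⟩ : ∃ r₀, 0 < r₀ ∧ Metric.closedBall y r₀ ⊆ NonCoincident 3 (2 * p) :=
    Metric.nhds_basis_closedBall.mem_iff.1 ((isOpen_nonCoincident 3 (2 * p)).mem_nhds hy)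
  obtain ⟨-, hequi⟩ := hUR.1 (2 * p) (Metric.closedBall y r₀) hball (isCompact_closedBall y r₀)
  -- a coordinate bound `Z`
  obtain ⟨Z, hZ⟩ := Finite.exists_le (fun q : Fin (2 * p) × Fin 3 => (z q.1 q.2).natAbs)
  refine exists_tendsto_of_forall_close fun ε hε => ?_
  obtain ⟨r, δ₀, hr, hδ₀, hcont⟩ := hequi ε hε
  have hr' : 0 < min r r₀ := lt_min hr hr₀
  -- (2) the block parameter `j > 4 / min r r₀`
  obtain ⟨j, hj⟩ := exists_nat_gt (4 / min r r₀)
  have hjR : (0 : ℝ) < j := lt_trans (by positivity) hj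
  have hjpos : 0 < j := by exact_mod_cast hjR
  -- block offsets `j • z`, injective; their block limit
  have hkk_inj : Function.Injective (fun i => (j : ℤ) • z i) := by
    intro i i' h
    refine hz_inj (funext fun k => ?_)
    have hk := congr_fun h k
    simp only [Pi.smul_apply, smul_eq_mul] at hk
    exact mul_left_cancel₀ (by exact_mod_cast hjpos.ne') hk
  obtain ⟨Mlim, hM⟩ := hBL (2 * p) (by omega) (fun i => (j : ℤ) • z i) hkk_inj
  obtain ⟨c, hc⟩ := tendsto_blockCov_div_of_twoPointScaling hTS hjpos
  have hLt : Tendsto (fun m : ℕ => m / j) atTop atTop := Nat.tendsto_div_const_atTop hjpos.ne'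
  -- (3) the approximants `A(m) = R_{2p}(⌊m/j⌋; j z⃗) · (V/(L⁶ g(m)))^p`
  refine ⟨fun m => critBlockMoment (2 * p) (m / j) (fun i => (j : ℤ) • z i) *
      (blockCov (m / j) 0 / (((m / j : ℕ) : ℝ) ^ 6 * criticalTwoPoint 3 (Pi.single 0 (m : ℤ)))) ^ p,
    Mlim * c ^ p, (hM.comp hLt).mul (hc.pow p), ?_⟩
  -- (4) eventual `ε`-closeness
  have hev1 : ∀ᶠ m : ℕ in atTop, 1 / (m : ℝ) < δ₀ :=
    tendsto_one_div_atTop_nhds_zero_nat.eventually (gt_mem_nhds hδ₀)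
  have hev2 : ∀ᶠ m : ℕ in atTop, 2 * (1 / (j : ℝ) + (j : ℝ) * Z / (m : ℝ)) < min r r₀ := by
    have ht : Tendsto (fun m : ℕ => 2 * (1 / (j : ℝ) + (j : ℝ) * Z / (m : ℝ))) atTop
        (𝓝 (2 * (1 / (j : ℝ) + 0))) :=
      (tendsto_const_nhds.add (tendsto_const_div_atTop_nhds_zero_nat _)).const_mul 2
    refine ht.eventually (gt_mem_nhds ?_)
    have h4 := (div_lt_iff₀ hr').1 hj
    rw [add_zero, mul_one_div, div_lt_iff₀ hjR]
    linarith
  filter_upwards [eventually_ge_atTop j, hev1, hev2] with m hmj hmδ hmr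
  have hm : 0 < m := lt_of_lt_of_le hjpos hmj
  have hmR : (0 : ℝ) < m := by exact_mod_cast hm
  have hL1 : 1 ≤ m / j := (Nat.le_div_iff_mul_le hjpos).2 (by simpa using hmj)
  have hLpos : (0 : ℝ) < ((m / j : ℕ) : ℝ) := by exact_mod_cast hL1
  set L := m / j with hL
  set S := Fintype.piFinset (fun _ : Fin (2 * p) => cube L) with hS
  set X : (Fin (2 * p) → Site 3) → Fin (2 * p) → EuclideanSpace ℝ (Fin 3) := fun x i =>
    WithLp.toLp 2 fun k' => (((x i + (L : ℤ) • ((j : ℤ) • z i)) k' : ℤ) : ℝ) / (m : ℝ) with hX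
  set G : (Fin (2 * p) → Site 3) → ℝ := fun x =>
    rescaledCorrelator (criticalCorr 3) rhoPin (2 * p) (1 / (m : ℝ)) (X x) with hG
  -- every block configuration is `ε`-close in value (clause (b))
  have hclose : ∀ x ∈ S,
      |G x - rescaledCorrelator (criticalCorr 3) rhoPin (2 * p) (1 / (m : ℝ)) y| < ε := by
    intro x hx
    have hdist : dist (X x) y < min r r₀ :=
      dist_blockConfig_lt hz (fun i k => hZ (i, k)) hjpos hm hmr hx
    exact hcont (1 / (m : ℝ)) ⟨one_div_pos.2 hmR, hmδ⟩ (X x)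
      (Metric.mem_closedBall.2 (hdist.le.trans (min_le_right _ _))) y
      (Metric.mem_closedBall_self hr₀.le) (lt_of_lt_of_le hdist (min_le_left _ _))
  -- the de-smearing identity and the number of block configurations
  have hsum : ∑ x ∈ S, G x = ((L : ℝ) ^ 3) ^ (2 * p) *
      (critBlockMoment (2 * p) L (fun i => (j : ℤ) • z i) *
        (blockCov L 0 / ((L : ℝ) ^ 6 * criticalTwoPoint 3 (Pi.single 0 (m : ℤ)))) ^ p) :=
    sum_rescaledCorrelator_blockConfig hL1 hm.ne' _
  have hcard : (S.card : ℝ) = ((L : ℝ) ^ 3) ^ (2 * p) := by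
    rw [hS, Fintype.card_piFinset_const, card_cube]
    push_cast
    ring
  have hc0 : ((L : ℝ) ^ 3) ^ (2 * p) ≠ 0 := pow_ne_zero _ (pow_ne_zero _ hLpos.ne')
  have hcard_pos : (0 : ℝ) < S.card := by
    rw [hcard]
    positivity
  -- averaging
  have key : rescaledCorrelator (criticalCorr 3) rhoPin (2 * p) (1 / (m : ℝ)) y -
      critBlockMoment (2 * p) L (fun i => (j : ℤ) • z i) *
        (blockCov L 0 / ((L : ℝ) ^ 6 * criticalTwoPoint 3 (Pi.single 0 (m : ℤ)))) ^ p =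
      (S.card : ℝ)⁻¹ *
        ∑ x ∈ S, (rescaledCorrelator (criticalCorr 3) rhoPin (2 * p) (1 / (m : ℝ)) y - G x) := by
    rw [Finset.sum_sub_distrib, Finset.sum_const, nsmul_eq_mul, hsum, hcard, mul_sub, ← mul_assoc,
      ← mul_assoc, inv_mul_cancel₀ hc0, one_mul, one_mul]
  rw [key, abs_mul, abs_inv, abs_of_pos hcard_pos]
  calc (S.card : ℝ)⁻¹ * |∑ x ∈ S, (rescaledCorrelator (criticalCorr 3) rhoPin (2 * p) (1 / (m : ℝ)) y - G x)|
      ≤ (S.card : ℝ)⁻¹ * ∑ x ∈ S, |rescaledCorrelator (criticalCorr 3) rhoPin (2 * p) (1 / (m : ℝ)) y - G x| := by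
        gcongr
        exact Finset.abs_sum_le_sum_abs _ _
    _ ≤ (S.card : ℝ)⁻¹ * ∑ _x ∈ S, ε := by
        gcongr with x hx
        rw [abs_sub_comm]
        exact (hclose x hx).le
    _ = ε := by
        rw [Finset.sum_const, nsmul_eq_mul, ← mul_assoc, inv_mul_cancel₀ hcard_pos.ne', one_mul]

end Summit.CriticalPhenomena.Ising3DConformalLimit.Cruxes.ExistsScaleCovariantLimit.MonotoneBlockingPort

end
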